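import Literature.Analysis.FluidPDE.RusinSverakLeraySolutions
import HarnessLib

/-!
# Named facts: the three printed ingredients of Rusin–Šverák's weak stability of singular
points (`rusin_sverak_leray_singular_points_stable`) — weak stability of `NS(u₀)` (Thm. 4.2 with
Lemma 4.1 and Prop. 2.2), stability of singularities (Lemma 2.1), and backward-cylinder
regularity — and the reduction of **S** to them

Decomposition file (D-0014 named facts) for the fact
`S = Literature.Analysis.FluidPDE.rusin_sverak_leray_singular_points_stable`
(`RusinSverakLeraySolutions.lean`; Rusin–Šverák, J. Funct. Anal. 260 (2011) 879–891 =
arXiv:0911.0500, **Thm. 4.2 with Lemma 2.1, via Lemma 4.1 and Prop. 2.2** — the printed proof of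
Cor. 4.2, p. 8: "Apply the theorem, together with Lemma 4.1, Proposition 2.2 and Lemma 2.1"):
if `Ḣ^{1/2}`-bounded data `v₀^k ⇀ v₀` weakly in `Ḣ^{1/2}`, `(u^k, p^k) ∈ NS(v₀^k)` are Leray
solutions singular at `(T, x_k)` (essentially unbounded on every backward cylinder `Q_r(T, x_k)`),
`T > 0`, `x_k → x_∞`, then some `(u, p) ∈ NS(v₀)` is singular at `(T, x_∞)`. Against Mathlib this
is a theory, not a lemma (triage XL): it is the Caffarelli–Kohn–Nirenberg / Lemarié-Rieusset local
theory (ε-regularity — itself the undischarged named facts `ckn_epsilon_regularity`,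
`lemarieRieusset_epsilon_regularity` of `PartialRegularity.lean` / `CKNEpsilonRegularity.lean` —,
Calderón–Zygmund pressure estimates, Aubin–Lions compactness, Lemarié-Rieusset's a priori
estimate). This file vendors the three printed results of which **S** is the conjunction, each as
its own named fact in the tree's vocabulary, and **proves** the bookkeeping `K → L → B → S`:

* `RusinSverak2011.CompactnessSituation O useq pseq u p` (definition) — "the situation of
  Proposition 2.2" (Rusin–Šverák §2 p. 4 = Jia–Šverák 2013 Lemma 5): suitable weak solutions
  `(u^k, p^k)` on an open space–time set `O`, `u^k` uniformly bounded in the energy space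
  `L^∞_t L²_x ∩ L²_t Ḣ¹_x` and `p^k` uniformly bounded in `L^{3/2}` on compact subsets of `O`,
  `u^k → u` in `L³` and `p^k ⇀ p` weakly in `L^{3/2}` on compact subsets of `O`;
* **K** `rusin_sverak_leray_weak_stability` — **Thm. 4.2** (weak stability of the set `NS(u₀)`
  of Leray solutions) in the existential packaging supplied by **Lemma 4.1** (Lemarié-Rieusset's a
  priori estimate, with its pressure renormalisation `p - p_{x₀,r}(t)`) and **Prop. 2.2**
  (compactness): from `(u^k, p^k) ∈ NS(v₀^k)` with `v₀^k` bounded and weakly convergent to `v₀` in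
  `Ḣ^{1/2}` one extracts a subsequence, pressures `q^k` differing from `p^{φ(k)}` by functions of
  time ("we can change the pressure by any function depending on `t` only", p. 4), and a Leray
  solution `(u, p) ∈ NS(v₀)` such that `(u^{φ(k)}, q^k) → (u, p)` in the situation of Prop. 2.2 on
  `O = (0, ∞) × ℝ³`;
* **L** `rusin_sverak_stability_of_singularities` — **Lemma 2.1** (= Jia–Šverák 2013 Lemma 6):
  in the situation of Prop. 2.2, limits of singular points `z^k → z₀ ∈ O` of `(u^k, p^k)` are
  singular points of `(u, p)`; "regular" in the neighbourhood sense of the sources (Rusin–Šverák: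
  Hölder continuous near `z₀`; Jia–Šverák / Caffarelli–Kohn–Nirenberg / Robinson–Rodrigo–Sadowski
  Def. 15.1: bounded near `z₀`), i.e. the tree's `IsRegularPoint` (bounded on a centred cylinder
  `Q*_ρ(z₀)`);
* **B** `isRegularPoint_of_eLpNorm_parabolicCylinder_lt_top` — the folklore bridge between the
  two customary conventions for regular points of suitable weak solutions at interior times: a
  suitable weak solution essentially bounded on a *backward* cylinder `Q_r(z) ⊆ O` is bounded on a
  full neighbourhood of `z` (Lemarié-Rieusset 2016 p. 566 and Ladyzhenskaya–Seregin define regular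
  points by backward cylinders, CKN 1982 §6 / Robinson–Rodrigo–Sadowski 2016 Def. 15.1 by
  neighbourhoods; Robinson–Rodrigo–Sadowski p. 287 note that the one-scale criterion on `Q_r(z)`
  "does not guarantee that `z` is a regular point" and apply it on cylinders `Q_r(x, t + r²/8)`
  with tops in the future of `z`, Cor. 15.6 — which, with the pressure split of the proof of
  Lemma 2.1 = Lemarié-Rieusset Thm. 15.2 (A) and the absolute continuity of
  `∫∫ |u|³ + |p|^{3/2}` on the thin slab `[t, t + δ] × B`, is the proof of **B**);

and proves `rusin_sverak_leray_singular_points_stable_of_weak_stability : K → L → B → S`: **K**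
yields `(u, p) ∈ NS(v_∞)` and the situation of Prop. 2.2 along a subsequence; were `u` bounded on
some `Q_r(T, x_∞)`, it would be bounded on `Q_ρ(T, x_∞) ⊆ (0,∞) × ℝ³`, `ρ = min(r, √T)`, hence
(**B**) regular at `(T, x_∞)`; but the `u^{φ(k)}` are singular at `(T, x_{φ(k)}) → (T, x_∞)` (a
field unbounded on every backward cylinder is unbounded on every centred one), so (**L**) `u` is
singular at `(T, x_∞)` — contradiction. The corollaries restate Cor. 4.3 / Cor. 4.2 of
`RusinSverakLeraySolutions.lean` over the finer leaves **E, W, R, K, L, B** (and `N′`,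
`kato_local`).

Transcription notes. (1) **K** keeps the data exactly as **S** and Thm. 4.2 have them — `L³`
fields represented by classes `g_k ∈ Ḣ^{1/2}(ℝ³; ℂ³)` with `‖g_k‖ ≤ R` and `⟪g_k, w⟫ → ⟪g_∞, w⟫` —
so that no Sobolev-embedding glue enters the reduction; the `L³` form of the same statement
(data bounded and weakly convergent in `L³`: Jia–Šverák 2013, proof of Thm. 1 with Cor. 1 and
Lemma 8; Lemarié-Rieusset 2016, proof of Thm. 15.5, pp. 570–571) implies it through
`exists_eLpNorm_three_le_of_represents_of_norm_le` and
`HomSobolev.Represents.tendsto_inner_integral_smul_of_memLp` (`HomSobolevRepresentedL3.lean`).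
(2) Thm. 4.2 is printed for a sequence already converging in `𝒟'` and identifies *that* limit;
**K** only asserts what Lemma 4.1 + Prop. 2.2 + Thm. 4.2 give for *some* subsequence (weaker than
print, as is **S**, cf. note (2) of `RusinSverakLeraySolutions.lean`). The pressures of the
subsequence are renormalised (`q^k`), because the tree's `IsLocalLeraySolution` fixes the pressure
only up to `L^{3/2}_loc` functions of time, for which no bound uniform in `k` can hold; the limit
pressure `p` is the weak limit of the `q^k` and is a pressure of the Leray solution `u` (Prop. 2.2:
"then `(u, p)` is again a suitable weak solution"; `p ∈ L^{3/2}_loc` up to `t = 0` by the uniform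
bound of Lemma 4.1 = Jia–Šverák Cor. 1 on `B_r(x₀) × (0, r²)`). That the limit lies in the tree's
class `IsLocalLeraySolution` (Kang–Miura–Tsai Def. 3.2: uniformly local energy for every `R`,
decay (7) at spatial infinity) is, beyond the printed "u ∈ NS(u₀)", Jia–Šverák's Cor. 1 (all
radii, constants depending on `sup_k ‖v₀^k‖_{L³}`) and Kikuchi–Seregin's decay lemma
(Kang–Miura–Tsai 2021 Lemma 3.3, with Lemma 3.4) for the limit, whose pressure formula passes to the
limit. (3) **L** does not assume `(u, p)` suitable (Prop. 2.2 provides it, and the printed proof of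
Lemma 2.1 uses of the limit only that `u` is bounded near `z₀`). (4) Weak `L^{3/2}` convergence on
a compact `K` is tested against `L³(K)`; strong `L³` convergence is `∫_K ‖u^k - u‖³ → 0`; the energy
bounds copy the fields `energyClass` / `localEnergy` of `IsSuitableWeakSolutionOn` with constants
uniform in `k`. (5) Unit viscosity and zero force throughout, as in the sources.

## Mathlib / tree search

Tree: `IsRegularPoint`, `parabolicCylinder(_subset_centered)`, `IsSuitableWeakSolutionOn`,
`HasWeakSpatialGradientOn`, `slab`/`mem_slab`/`coe_slab` (`SuitableWeak.lean`, `WeakSolution.lean`);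
`isSuitableWeakSolutionOn_zero`, `hasWeakSpatialGradientOn_zero` (`LocalLeraySolutions.lean`);
nothing named `*stability_of_singular*`, `*weak_stability*`, `CompactnessSituation`
(`lean search`). The ε-regularity inputs of **L**/**B** are the named facts
`lemarieRieusset_epsilon_regularity` (Thm. 14.4) / `ckn_epsilon_regularity`. Mathlib:
`Filter.Tendsto.prodMk_nhds`, `StrictMono.tendsto_atTop`, `eLpNorm_mono_measure`.

## References

* W. Rusin, V. Šverák, J. Funct. Anal. 260 (2011) 879–891 = arXiv:0911.0500: §2 p. 4 (Prop. 2.1,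
  Prop. 2.2, Lemma 2.1 and its proof), §4 pp. 6–8 (`NS(u₀)`, Lemma 4.1, Thm. 4.2, Cor. 4.2).
* H. Jia, V. Šverák, SIAM J. Math. Anal. 45 (2013) = arXiv:1201.1592: Def. 1, Lemma 2, Cor. 1,
  Lemmas 5–8, proof of Thm. 1.
* P. G. Lemarié-Rieusset, *The Navier–Stokes problem in the 21st century* (2016): Thm. 14.4,
  Thm. 15.1, definition of regular points p. 566, Thm. 15.2, proof of Thm. 15.5 pp. 570–573.
* K. Kang, H. Miura, T.-P. Tsai, IMRN 2021 = arXiv:1812.10509, §3: Def. 3.1, Def. 3.2,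
  Lemmas 3.3–3.5.
* J. C. Robinson, J. L. Rodrigo, W. Sadowski, *The three-dimensional Navier–Stokes equations*
  (2016): Def. 15.1, Thm. 15.4, Cor. 15.6 and the remark between them.
* L. Caffarelli, R. Kohn, L. Nirenberg, CPAM 35 (1982), §2, §6.
-/

noncomputable section

open MeasureTheory TopologicalSpace Filter Topology Set Function Metric Bornology
open scoped ENNReal NNReal InnerProductSpace

namespace Literature.Analysis.FluidPDE

local notation "ℝ³" => EuclideanSpace ℝ (Fin 3)
local notation "ℂ³" => EuclideanSpace ℂ (Fin 3)

/-! ## "The situation of Proposition 2.2" -/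

/-- **The situation of Rusin–Šverák's Proposition 2.2** (compactness of suitable weak solutions;
J. Funct. Anal. 260 (2011) = arXiv:0911.0500, §2 p. 4, Prop. 2.2 and the opening words of
Lemma 2.1 "In the situation of Proposition 2.2"; verbatim Jia–Šverák 2013, Lemma 5): on an open
space–time set `O ⊆ ℝ × ℝ³`, `(u^k, p^k)`, `k = 1, 2, …` are suitable weak solutions (unit
viscosity, no force) "such that `u^k` are uniformly bounded in the energy space
`L^∞_t L²_x ∩ L²_t Ḣ¹_x` on compact subsets of `O` and `p^k` are uniformly bounded in
`L^{3/2}_t L^{3/2}_x` on compact subsets of `O`", and "`u^k → u` in `L³_t L³_x` on compact subsets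
of `O` and `p^k ⇀ p` in `L^{3/2}_t L^{3/2}_x` on compact subsets of `O`". The uniform bounds copy
the local classes of `IsSuitableWeakSolutionOn` (`energyClass`, `localEnergy`: `∇u^k` is a weak
spatial gradient `G_k`) with constants independent of `k`; strong `L³(K)` convergence is
`∫_K ‖u^k - u‖³ → 0`, weak `L^{3/2}(K)` convergence is tested against `L³(K)`.
[cite: RusinSverak2011, Prop. 2.2 and Lemma 2.1 (arXiv:0911.0500 p. 4)] -/
structure RusinSverak2011.CompactnessSituation (O : Opens (ℝ × ℝ³)) (useq : ℕ → ℝ → ℝ³ → ℝ³)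
    (pseq : ℕ → ℝ → ℝ³ → ℝ) (u : ℝ → ℝ³ → ℝ³) (p : ℝ → ℝ³ → ℝ) : Prop where
  /-- Each `(u^k, p^k)` is a suitable weak solution (CKN) of the unforced unit-viscosity
  equations on `O`. -/
  suitable : ∀ k, IsSuitableWeakSolutionOn O 1 0 (useq k) (pseq k)
  /-- `u^k` uniformly bounded in `L^∞_t L²_x` on every compact `K ⊆ O`. -/
  energy_bound : ∀ K ⊆ (O : Set (ℝ × ℝ³)), IsCompact K → ∃ C : ℝ≥0, ∀ k, ∀ᵐ t : ℝ,
    ∫⁻ x, K.indicator (fun z : ℝ × ℝ³ => ‖useq k z.1 z.2‖ₑ ^ 2) (t, x) ≤ C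
  /-- `∇u^k` (weak spatial gradients `G_k` on `O`) uniformly bounded in `L²` on every compact
  `K ⊆ O`. -/
  gradient_bound : ∃ G : ℕ → ℝ → ℝ³ → ℝ³ →L[ℝ] ℝ³,
    (∀ k, HasWeakSpatialGradientOn O (useq k) (G k)) ∧
    ∀ K ⊆ (O : Set (ℝ × ℝ³)), IsCompact K → ∃ C : ℝ≥0, ∀ k,
      ∫⁻ z in K, ENNReal.ofReal (frobeniusNormSq (G k z.1 z.2)) ≤ C
  /-- `p^k` uniformly bounded in `L^{3/2}` on every compact `K ⊆ O`. -/
  pressure_bound : ∀ K ⊆ (O : Set (ℝ × ℝ³)), IsCompact K → ∃ C : ℝ≥0, ∀ k,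
    ∫⁻ z in K, ‖pseq k z.1 z.2‖ₑ ^ (3 / 2 : ℝ) ≤ C
  /-- `u^k → u` in `L³(K)` for every compact `K ⊆ O`. -/
  tendsto_lintegral : ∀ K ⊆ (O : Set (ℝ × ℝ³)), IsCompact K →
    Tendsto (fun k => ∫⁻ z in K, ‖useq k z.1 z.2 - u z.1 z.2‖ₑ ^ (3 : ℕ)) atTop (𝓝 0)
  /-- `p^k ⇀ p` weakly in `L^{3/2}(K)` (against every `ψ ∈ L³(K)`) for every compact `K ⊆ O`. -/
  tendsto_integral_pressure : ∀ K ⊆ (O : Set (ℝ × ℝ³)), IsCompact K →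
    ∀ ψ : ℝ × ℝ³ → ℝ, MemLp ψ 3 (volume.restrict K) →
      Tendsto (fun k => ∫ z in K, pseq k z.1 z.2 * ψ z) atTop (𝓝 (∫ z in K, p z.1 z.2 * ψ z))

namespace RusinSverak2011.CompactnessSituation

variable {O : Opens (ℝ × ℝ³)} {useq : ℕ → ℝ → ℝ³ → ℝ³} {pseq : ℕ → ℝ → ℝ³ → ℝ}
  {u : ℝ → ℝ³ → ℝ³} {p : ℝ → ℝ³ → ℝ}

/-- The situation of Prop. 2.2 is inherited by subsequences (all bounds are uniform in `k`, and
limits along `atTop` pass to strictly increasing subsequences). [folklore] -/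
theorem comp_strictMono (h : RusinSverak2011.CompactnessSituation O useq pseq u p) {φ : ℕ → ℕ}
    (hφ : StrictMono φ) :
    RusinSverak2011.CompactnessSituation O (fun k => useq (φ k)) (fun k => pseq (φ k)) u p where
  suitable k := h.suitable (φ k)
  energy_bound K hK hKc := by
    obtain ⟨C, hC⟩ := h.energy_bound K hK hKc
    exact ⟨C, fun k => hC (φ k)⟩
  gradient_bound := by
    obtain ⟨G, hG, hGb⟩ := h.gradient_bound
    refine ⟨fun k => G (φ k), fun k => hG (φ k), fun K hK hKc => ?_⟩
    obtain ⟨C, hC⟩ := hGb K hK hKc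
    exact ⟨C, fun k => hC (φ k)⟩
  pressure_bound K hK hKc := by
    obtain ⟨C, hC⟩ := h.pressure_bound K hK hKc
    exact ⟨C, fun k => hC (φ k)⟩
  tendsto_lintegral K hK hKc := (h.tendsto_lintegral K hK hKc).comp hφ.tendsto_atTop
  tendsto_integral_pressure K hK hKc ψ hψ :=
    (h.tendsto_integral_pressure K hK hKc ψ hψ).comp hφ.tendsto_atTop

end RusinSverak2011.CompactnessSituation

/-- **Non-vacuity**: the constant sequence of trivial flows `(u^k, p^k) = (0, 0)` converging to
`(0, 0)` is in the situation of Prop. 2.2 on any open set (all bounds `0`). [folklore] -/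
theorem RusinSverak2011.compactnessSituation_zero (O : Opens (ℝ × ℝ³)) :
    RusinSverak2011.CompactnessSituation O (fun _ => 0) (fun _ => 0) 0 0 where
  suitable _ := isSuitableWeakSolutionOn_zero O 1
  energy_bound K _ _ := ⟨0, fun _ => Eventually.of_forall fun t => by simp⟩
  gradient_bound := ⟨fun _ => 0, fun _ => hasWeakSpatialGradientOn_zero O, fun K _ _ =>
    ⟨0, fun _ => by simp [frobeniusNormSq_zero]⟩⟩
  pressure_bound K _ _ := ⟨0, fun _ => by
    simp only [Pi.zero_apply, enorm_zero]
    rw [ENNReal.zero_rpow_of_pos (by norm_num)]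
    simp⟩
  tendsto_lintegral K _ _ := by simp
  tendsto_integral_pressure K _ _ ψ _ := by simp

/-! ## The three named facts -/

/-- NAMED FACT **K** (weak stability of the set `NS(u₀)` of Leray solutions; Rusin–Šverák,
J. Funct. Anal. 260 (2011) = arXiv:0911.0500, **Thm. 4.2** p. 7: "Let `u₀^k` be a bounded sequence
of initial conditions in `Ḣ^{1/2}` converging weakly in `Ḣ^{1/2}` to `u₀`. Let `u_k ∈ NS(u₀^k)` be
Leray solutions of the Cauchy problem with initial conditions `u₀^k`. Assume that `u^k` converge
weakly to `u` in distributions. Then `u ∈ NS(u₀)`", whose proof begins "Using Lemma 4.1,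
Proposition 2.2 and Theorem 4.1, we see that it is enough to show that `u(t) → u₀` in `L²` on
every compact subset" — packaged, as in the printed proof of Cor. 4.2 ("Apply the theorem,
together with Lemma 4.1, Proposition 2.2 …"), with **Lemma 4.1** (Lemarié-Rieusset's a priori
estimate `‖u‖²_{ℰ(Q̃_{x₀,r})} ≤ C(‖u₀‖_{Ḣ^{1/2}}) r`, `∫∫_{Q̃_{x₀,r}} |p - p_{x₀,r}(t)|^{3/2} ≤ C r²`
"for a suitable function `p_{x₀,r}(t)` of `t`") and **Prop. 2.2** (compactness: such sequences
are compact in `L³` on compact subsets, and limits are suitable weak solutions), which supply a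
convergent subsequence; the `L³`-data version is Jia–Šverák 2013, proof of Thm. 1 (with Cor. 1,
Lemma 8) = Lemarié-Rieusset 2016, proof of Thm. 15.5 pp. 570–571). Transcription (module
docstring, notes (1)–(2)): data are weakly divergence-free `L³` fields `v₀^k` represented by
`g_k ∈ Ḣ^{1/2}(ℝ³; ℂ³)`, `‖g_k‖ ≤ R`, `g_k ⇀ g_∞` weakly, `g_∞` representing the weakly
divergence-free `L³` field `v_∞`; `(u^k, p^k) ∈ NS(v₀^k)` (`IsLocalLeraySolution 1`). Conclusion:
there are a subsequence `φ`, pressures `q^k` (renormalisations of `p^{φ(k)}` by functions of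
time, p. 4: "we can change the pressure by any function depending on `t` only") and a Leray
solution `(u, p) ∈ NS(v_∞)` such that `(u^{φ(k)}, q^k)` and `(u, p)` are in the situation of
Prop. 2.2 on `O = (0, ∞) × ℝ³` (`RusinSverak2011.CompactnessSituation`). Users take
`(h : rusin_sverak_leray_weak_stability)`.
[cite: RusinSverak2011, Thm. 4.2 with Lemma 4.1 and Prop. 2.2 (arXiv:0911.0500 pp. 4, 7)] -/
def rusin_sverak_leray_weak_stability : Prop :=
  ∀ (v₀ : ℕ → ℝ³ → ℝ³) (g : ℕ → FunctionSpaces.HomSobolev ℝ³ ℂ³ (1 / 2 : ℝ))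
    (u : ℕ → ℝ → ℝ³ → ℝ³) (p : ℕ → ℝ → ℝ³ → ℝ),
  (∀ k, MemLp (v₀ k) 3 volume ∧ (g k).Represents (FunctionSpaces.EuclideanSpace.complexify ∘ v₀ k) ∧
    IsWeaklyDivFree (v₀ k)) →
  (∃ R : ℝ, ∀ k, ‖g k‖ ≤ R) →
  (∀ k, IsLocalLeraySolution 1 (v₀ k) (u k) (p k)) →
  ∀ glim : FunctionSpaces.HomSobolev ℝ³ ℂ³ (1 / 2 : ℝ),
    (∀ w, Tendsto (fun n => ⟪g n, w⟫_ℂ) atTop (𝓝 ⟪glim, w⟫_ℂ)) →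
    ∀ vlim : ℝ³ → ℝ³, MemLp vlim 3 volume →
      glim.Represents (FunctionSpaces.EuclideanSpace.complexify ∘ vlim) → IsWeaklyDivFree vlim →
      ∃ φ : ℕ → ℕ, StrictMono φ ∧
        ∃ (ulim : ℝ → ℝ³ → ℝ³) (plim : ℝ → ℝ³ → ℝ) (q : ℕ → ℝ → ℝ³ → ℝ),
          IsLocalLeraySolution 1 vlim ulim plim ∧
          RusinSverak2011.CompactnessSituation (slab ℝ³ (Ioi 0) isOpen_Ioi)
            (fun k => u (φ k)) q ulim plim

/-- NAMED FACT **L** (stability of singularities; Rusin–Šverák, J. Funct. Anal. 260 (2011) =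
arXiv:0911.0500, **Lemma 2.1** p. 4: "In the situation of Proposition 2.2, assume that `z^k ∈ 𝒪`
are singular points of `(u^k, p^k)`, `k = 1, 2, …`, and that `z^k → z₀ ∈ 𝒪`. Then `z₀` is a
singular point of `(u, p)`" — proved from Prop. 2.1 (ε-regularity, = Lemarié-Rieusset 2016
Thm. 14.4 = `lemarieRieusset_epsilon_regularity`) and the pressure split `p^k = p̃^k + h^k`,
`p̃^k = R_iR_j(u^k_i u^k_j χ_B)` compact in `L^{3/2}`, `h^k` harmonic in `x`; verbatim Jia–Šverák
2013 Lemma 6, "a point `z₀` is called a singular point of a suitable weak solution `u` to NSE if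
`u` is not bounded in any neighborhood of `z₀`"). Here "regular" is the neighbourhood notion of
the sources — Rusin–Šverák §2: "`u` is Hölder continuous in a neighborhood of `z₀`", which for
suitable weak solutions is boundedness near `z₀` by Prop. 2.1; Robinson–Rodrigo–Sadowski 2016
Def. 15.1; CKN 1982 §6 — i.e. the tree's `IsRegularPoint` (essentially bounded on some centred
cylinder `Q*_ρ(z₀)`). Transcription (module docstring, note (3)): the situation of Prop. 2.2 is
`RusinSverak2011.CompactnessSituation O useq pseq u p`; the limit `(u, p)` is not separately
assumed suitable (Prop. 2.2 gives it; the printed proof uses only that `u` is bounded near `z₀`).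
Users take `(h : rusin_sverak_stability_of_singularities)`.
[cite: RusinSverak2011, Lemma 2.1 (arXiv:0911.0500 p. 4); = JiaSverak2013 Lemma 6] -/
def rusin_sverak_stability_of_singularities : Prop :=
  ∀ (O : Opens (ℝ × ℝ³)) (useq : ℕ → ℝ → ℝ³ → ℝ³) (pseq : ℕ → ℝ → ℝ³ → ℝ)
    (u : ℝ → ℝ³ → ℝ³) (p : ℝ → ℝ³ → ℝ),
  RusinSverak2011.CompactnessSituation O useq pseq u p →
  ∀ (z : ℕ → ℝ × ℝ³) (z₀ : ℝ × ℝ³), (∀ k, z k ∈ O) → z₀ ∈ O →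
    (∀ k, ¬ IsRegularPoint (useq k) (z k)) → Tendsto z atTop (𝓝 z₀) →
    ¬ IsRegularPoint u z₀

/-- NAMED FACT **B** (backward-cylinder boundedness makes an interior point regular). For a
suitable weak solution `(u, p)` (unit viscosity, no force) on an open set `O ⊆ ℝ × ℝ³` and
`z = (t, x) ∈ O`: if `u` is essentially bounded on some backward cylinder
`Q_r(z) = (t - r², t) × B_r(x) ⊆ O`, then `z` is a regular point in the neighbourhood sense
(`IsRegularPoint`: `u` essentially bounded on some centred cylinder `Q*_ρ(z)`). This is the
(folklore) equivalence, at interior times, of the two customary definitions of regular points —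
by backward cylinders (Lemarié-Rieusset 2016 p. 566: "`(t, x)` is regular if there exists `r > 0`
such that `v` is bounded on `Q_r(t, x)`"; Ladyzhenskaya–Seregin 1999) and by neighbourhoods
(Caffarelli–Kohn–Nirenberg 1982 §6; Robinson–Rodrigo–Sadowski 2016 Def. 15.1, who note p. 287 that
boundedness on `Q_{r/2}` alone "does not guarantee that `(0,0)` is a regular point" and therefore
apply the one-scale ε-regularity criterion on the cylinders `Q_r(x, t + r²/8)`, Cor. 15.6). Proof
(not in Mathlib's reach): by the pressure split of the proof of Rusin–Šverák's Lemma 2.1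
(= Lemarié-Rieusset Thm. 15.2 (A), p. 567) the scaled quantity
`ρ⁻² ∫∫_{Q_ρ} |u|³ + |p - m_ρ p(s)|^{3/2}` is small on the part of a shifted cylinder
`Q_ρ(t + δ, x')`, `|x' - x| < ρ`, below time `t` for `ρ` small, and on the thin slab
`[t, t + δ] × B_{2ρ}(x)` for `δ` small by absolute continuity of the integral; the ε-regularity
criterion (Rusin–Šverák Prop. 2.1 = Lemarié-Rieusset Thm. 14.4, `lemarieRieusset_epsilon_regularity`)
then bounds `u` by `C/ρ` on `⋃ Q_{ρ/2}(t + δ, x') ⊇ Q*_{ρ'}(z)`. Users take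
`(h : isRegularPoint_of_eLpNorm_parabolicCylinder_lt_top)`. [folklore] -/
def isRegularPoint_of_eLpNorm_parabolicCylinder_lt_top : Prop :=
  ∀ (O : Opens (ℝ × ℝ³)) (u : ℝ → ℝ³ → ℝ³) (p : ℝ → ℝ³ → ℝ),
    IsSuitableWeakSolutionOn O 1 0 u p →
    ∀ z ∈ O, ∀ r : ℝ, 0 < r → parabolicCylinder r z ⊆ (O : Set (ℝ × ℝ³)) →
      eLpNorm (uncurry u) ∞ (volume.restrict (parabolicCylinder r z)) < ∞ → IsRegularPoint u z

/-! ## Glue: backward singularity and the neighbourhood convention -/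

/-- **A field unbounded on every backward cylinder at `z` is not regular at `z`** (the trivial
direction between the two conventions: `Q_ρ(z) ⊆ Q*_ρ(z)` and `L^∞` norms are monotone in the
set). [folklore] -/
theorem not_isRegularPoint_of_eLpNorm_parabolicCylinder_eq_top {u : ℝ → ℝ³ → ℝ³} {z : ℝ × ℝ³}
    (h : ∀ r : ℝ, 0 < r → eLpNorm (uncurry u) ∞ (volume.restrict (parabolicCylinder r z)) = ∞) :
    ¬ IsRegularPoint u z := by
  rintro ⟨ρ, hρ, hlt⟩
  have hmono : eLpNorm (uncurry u) ∞ (volume.restrict (parabolicCylinder ρ z)) ≤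
      eLpNorm (uncurry u) ∞ (volume.restrict (parabolicCylinderCentered ρ z)) :=
    eLpNorm_mono_measure (uncurry u)
      (Measure.restrict_mono (parabolicCylinder_subset_centered ρ z) le_rfl)
  rw [h ρ hρ, top_le_iff] at hmono
  exact hlt.ne hmono

/-- A backward cylinder `Q_ρ(T, x)` with `ρ² ≤ T` lies in the open slab `(0, ∞) × ℝ³`. [folklore] -/
theorem parabolicCylinder_subset_slab_Ioi {ρ T : ℝ} (hρT : ρ ^ 2 ≤ T) (x : ℝ³) :
    parabolicCylinder ρ ((T : ℝ), x) ⊆ ((slab ℝ³ (Ioi 0) isOpen_Ioi : Opens (ℝ × ℝ³)) : Set (ℝ × ℝ³)) := by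
  intro z hz
  rw [mem_parabolicCylinder] at hz
  rw [coe_slab]
  exact ⟨show (0 : ℝ) < z.1 by linarith [hz.1.1], mem_univ _⟩

/-! ## The reduction `K → L → B → S` -/

/-- **Rusin–Šverák's weak stability of singular points (`S = rusin_sverak_leray_singular_points_stable`,
Thm. 4.2 with Lemma 2.1 via Lemma 4.1 and Prop. 2.2) from its three printed ingredients**: weak
stability of `NS(u₀)` (**K**), stability of singularities (**L**) and backward-cylinder
regularity (**B**). Proof (arXiv:0911.0500 p. 8, proof of Cor. 4.2, first three of its four
citations): **K** gives a subsequence `φ`, renormalised pressures `q^k` and `(u, p) ∈ NS(v_∞)` in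
the situation of Prop. 2.2 on `(0, ∞) × ℝ³`; if `u` were essentially bounded on some
`Q_r(T, x_∞)`, it would be so on `Q_ρ(T, x_∞) ⊆ (0,∞) × ℝ³`, `ρ = min(r, √T)`, hence regular at
`(T, x_∞)` (**B**); the `u^{φ(k)}` being singular at `(T, x_{φ(k)}) → (T, x_∞)` (unbounded on all
backward, hence all centred, cylinders), **L** makes `(T, x_∞)` singular for `u` — contradiction.
[cite: RusinSverak2011, Thm. 4.2 with Lemma 2.1, proof of Cor. 4.2 (arXiv:0911.0500 pp. 4, 7–8)] -/
theorem rusin_sverak_leray_singular_points_stable_of_weak_stability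
    (hK : rusin_sverak_leray_weak_stability) (hL : rusin_sverak_stability_of_singularities)
    (hB : isRegularPoint_of_eLpNorm_parabolicCylinder_lt_top) :
    rusin_sverak_leray_singular_points_stable := by
  intro T hT v₀ g u p x hdata hbdd hleray hsing xlim hx glim hweak vlim hv3 hvrep hvdiv
  obtain ⟨φ, hφ, ulim, plim, q, hulim, hsit⟩ :=
    hK v₀ g u p hdata hbdd hleray glim hweak vlim hv3 hvrep hvdiv
  refine ⟨ulim, plim, hulim, fun r hr => ?_⟩
  by_contra hne
  -- a small backward cylinder inside the slab on which `ulim` would be bounded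
  set ρ : ℝ := min r (Real.sqrt T) with hρ_def
  have hρ : 0 < ρ := lt_min hr (Real.sqrt_pos.2 hT)
  have hρr : ρ ≤ r := min_le_left _ _
  have hρT : ρ ^ 2 ≤ T := by
    calc ρ ^ 2 ≤ Real.sqrt T ^ 2 := pow_le_pow_left₀ hρ.le (min_le_right _ _) 2
      _ = T := Real.sq_sqrt hT.le
  have hmonoQ : parabolicCylinder ρ ((T : ℝ), xlim) ⊆ parabolicCylinder r ((T : ℝ), xlim) := by
    have h2 : ρ ^ 2 ≤ r ^ 2 := pow_le_pow_left₀ hρ.le hρr 2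
    exact prod_mono (Ioo_subset_Ioo (by linarith) le_rfl) (ball_subset_ball hρr)
  have hlt : eLpNorm (uncurry ulim) ∞ (volume.restrict (parabolicCylinder ρ ((T : ℝ), xlim))) < ∞ :=
    lt_of_le_of_lt (eLpNorm_mono_measure (uncurry ulim) (Measure.restrict_mono hmonoQ le_rfl))
      (lt_top_iff_ne_top.2 hne)
  have hreg : IsRegularPoint ulim ((T : ℝ), xlim) :=
    hB _ ulim plim hulim.suitable ((T : ℝ), xlim) (mem_slab.2 (mem_Ioi.2 hT)) ρ hρ
      (parabolicCylinder_subset_slab_Ioi hρT xlim) hlt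
  -- the approximating Leray solutions are singular at `(T, x_{φ k}) → (T, x_∞)`
  have hsingk : ∀ k, ¬ IsRegularPoint (u (φ k)) ((T : ℝ), x (φ k)) := fun k =>
    not_isRegularPoint_of_eLpNorm_parabolicCylinder_eq_top (hsing (φ k))
  have hz : Tendsto (fun k => ((T : ℝ), x (φ k))) atTop (𝓝 ((T : ℝ), xlim)) :=
    tendsto_const_nhds.prodMk_nhds (hx.comp hφ.tendsto_atTop)
  exact hL _ _ _ _ _ hsit (fun k => ((T : ℝ), x (φ k))) ((T : ℝ), xlim)
    (fun k => mem_slab.2 (mem_Ioi.2 hT)) (mem_slab.2 (mem_Ioi.2 hT)) hsingk hz hreg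

/-! ## Corollaries: Cor. 4.2 / Cor. 4.3 over the finer leaves -/

/-- **Rusin–Šverák's Cor. 4.2 (`rusin_sverak_weak_limit_of_singular_points`) from E, W, R and the
three ingredients K, L, B of S** (`rusin_sverak_weak_limit_of_singular_points_of_leray_theory` with
`S` supplied by `rusin_sverak_leray_singular_points_stable_of_weak_stability`).
[cite: RusinSverak2011, Cor. 4.2 and its proof (arXiv:0911.0500 p. 8)] -/
theorem rusin_sverak_weak_limit_of_singular_points_of_weak_stability
    (hE : leray_solution_exists_of_memLp_three) (hW : leray_solution_ae_eq_kato)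
    (hR : kato_solution_le_div_sqrt) (hK : rusin_sverak_leray_weak_stability)
    (hL : rusin_sverak_stability_of_singularities)
    (hB : isRegularPoint_of_eLpNorm_parabolicCylinder_lt_top) :
    rusin_sverak_weak_limit_of_singular_points :=
  rusin_sverak_weak_limit_of_singular_points_of_leray_theory hE hW hR
    (rusin_sverak_leray_singular_points_stable_of_weak_stability hK hL hB)

/-- **Rusin–Šverák, Cor. 4.3, second clause (`rusin_sverak_minimal_data_compact`), from the current
leaves of the DAG**: `N′ = rusin_sverak_singularity_at_katoMaximalTime`, E, W, R, the three
ingredients K, L, B of S, and `kato_local` (`rusin_sverak_minimal_data_compact_of_leray_theory'`).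
[cite: RusinSverak2011, Cor. 4.3 (arXiv:0911.0500 p. 8)] -/
theorem rusin_sverak_minimal_data_compact_of_weak_stability
    (hN' : rusin_sverak_singularity_at_katoMaximalTime) (hE : leray_solution_exists_of_memLp_three)
    (hW : leray_solution_ae_eq_kato) (hR : kato_solution_le_div_sqrt)
    (hK : rusin_sverak_leray_weak_stability) (hL : rusin_sverak_stability_of_singularities)
    (hB : isRegularPoint_of_eLpNorm_parabolicCylinder_lt_top) (hLoc : kato_local) :
    rusin_sverak_minimal_data_compact :=
  rusin_sverak_minimal_data_compact_of_leray_theory' hN' hE hW hR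
    (rusin_sverak_leray_singular_points_stable_of_weak_stability hK hL hB) hLoc

/-- **Rusin–Šverák, Cor. 4.3, first clause (`rusin_sverak_minimal_blowup`), from the current leaves
of the DAG** (`N′`, E, W, R, K, L, B, `kato_local`; `rusin_sverak_minimal_blowup_of_leray_theory'`).
[cite: RusinSverak2011, Cor. 4.3 (arXiv:0911.0500 p. 8)] -/
theorem rusin_sverak_minimal_blowup_of_weak_stability
    (hN' : rusin_sverak_singularity_at_katoMaximalTime) (hE : leray_solution_exists_of_memLp_three)
    (hW : leray_solution_ae_eq_kato) (hR : kato_solution_le_div_sqrt)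
    (hK : rusin_sverak_leray_weak_stability) (hL : rusin_sverak_stability_of_singularities)
    (hB : isRegularPoint_of_eLpNorm_parabolicCylinder_lt_top) (hLoc : kato_local) :
    rusin_sverak_minimal_blowup :=
  rusin_sverak_minimal_blowup_of_leray_theory' hN' hE hW hR
    (rusin_sverak_leray_singular_points_stable_of_weak_stability hK hL hB) hLoc

end Literature.Analysis.FluidPDE
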